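import Mathlib
import Summits.Ventures.PercRepro2.Defs
import Summits.Ventures.PercRepro2.Graph
import Summits.Ventures.PercRepro2.Events
import Summits.Ventures.PercRepro2.Harris
import Summits.Ventures.PercRepro2.XWForm
import Summits.Ventures.PercRepro2.XWCycle

/-!
# Relabelling transport for the (XW) form (PercRepro2, p2 g24)

A graph automorphism — an edge permutation `σ : E ≃ E` over a vertex bijection `φ` with
`ends (σ e) = Sym2.map φ (ends e)` — carries the bilinear form of (XW) along:
**`xwBil_relabel`**: `xwBil ends (φ s) (φ y) (φ o) (φ u) p p = xwBil ends s y o u (p ∘ σ) (p ∘ σ)`.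
The configuration map is `Ψ ω = ω ∘ σ` (`weight_comp`: the product weight is reindexed),
connectivity is carried along `φ` (`conn_comp_iff`, by `Relation.ReflTransGen` induction both
ways), and `XWCycle.xwBil_transport'` does the rest.  Used to spread a certificate at one
placement of the marks over every placement (`XWKFive.lean`).  Own work; standard axioms.
-/

namespace Summit.Ventures.PercRepro2

namespace XWRelabel

section Transport

variable {V : Type*} {E : Type*} [Fintype E] [DecidableEq E] {R : Type*} [CommRing R]

omit [Fintype E] [DecidableEq E] in
/-- Open adjacency is carried along a graph automorphism. -/
lemma openAdj_comp_iff {ends : E → Sym2 V} (σ : E ≃ E) {φ : V → V} (hφ : Function.Injective φ)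
    (hcomp : ∀ e, ends (σ e) = Sym2.map φ (ends e)) (ω : Config E) (a b : V) :
    OpenAdj ends (ω ∘ σ) a b ↔ OpenAdj ends ω (φ a) (φ b) := by
  constructor
  · rintro ⟨e, he, hends⟩
    refine ⟨σ e, he, ?_⟩
    rw [hcomp, hends, Sym2.map_mk]
  · rintro ⟨e', he', hends'⟩
    refine ⟨σ.symm e', by simpa using he', ?_⟩
    have h := hcomp (σ.symm e')
    rw [Equiv.apply_symm_apply, hends'] at h
    exact Sym2.map.injective hφ (by rw [← h, Sym2.map_mk])

omit [Fintype E] [DecidableEq E] in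
/-- Adjacency of the open subgraph is carried along a graph automorphism. -/
lemma adj_comp_iff {ends : E → Sym2 V} (σ : E ≃ E) {φ : V → V} (hφ : Function.Injective φ)
    (hcomp : ∀ e, ends (σ e) = Sym2.map φ (ends e)) (ω : Config E) (a b : V) :
    (openGraph ends (ω ∘ σ)).Adj a b ↔ (openGraph ends ω).Adj (φ a) (φ b) := by
  rw [openGraph_adj, openGraph_adj, openAdj_comp_iff σ hφ hcomp, hφ.ne_iff]

omit [Fintype E] [DecidableEq E] in
/-- Connectivity is carried along a graph automorphism. -/
lemma conn_comp_iff {ends : E → Sym2 V} (σ : E ≃ E) (φ : V ≃ V)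
    (hcomp : ∀ e, ends (σ e) = Sym2.map φ (ends e)) (ω : Config E) (a b : V) :
    Conn ends (ω ∘ σ) a b ↔ Conn ends ω (φ a) (φ b) := by
  unfold Conn
  rw [SimpleGraph.reachable_iff_reflTransGen, SimpleGraph.reachable_iff_reflTransGen]
  constructor
  · intro h
    induction h with
    | refl => exact Relation.ReflTransGen.refl
    | tail _ hadj ih =>
      exact Relation.ReflTransGen.tail ih ((adj_comp_iff σ φ.injective hcomp ω _ _).1 hadj)
  · intro h
    have key : ∀ x z, Relation.ReflTransGen (openGraph ends ω).Adj x z →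
        Relation.ReflTransGen (openGraph ends (ω ∘ σ)).Adj (φ.symm x) (φ.symm z) := by
      intro x z hxz
      induction hxz with
      | refl => exact Relation.ReflTransGen.refl
      | tail _ hadj ih =>
        refine Relation.ReflTransGen.tail ih ?_
        rw [adj_comp_iff σ φ.injective hcomp, Equiv.apply_symm_apply, Equiv.apply_symm_apply]
        exact hadj
    have := key _ _ h
    rwa [Equiv.symm_apply_apply, Equiv.symm_apply_apply] at this

omit [DecidableEq E] in
/-- The product weight is reindexed along an edge permutation. -/
lemma weight_comp (p : E → R) (σ : E ≃ E) (ω : Config E) :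
    weight (p ∘ σ) (ω ∘ σ) = weight p ω := by
  unfold weight
  exact Equiv.prod_comp σ (fun e => edgeFactor (p e) (ω e))

/-- Probabilities are carried along an edge permutation: `P_{p ∘ σ}(A) = P_p((· ∘ σ)⁻¹ A)`. -/
lemma prob_comp (p : E → R) (σ : E ≃ E) (A : Set (Config E)) :
    prob (p ∘ σ) A = prob p ((fun ω : Config E => ω ∘ σ) ⁻¹' A) := by
  unfold prob
  have hΨ : Function.Bijective (fun ω : Config E => ω ∘ σ) :=
    (Equiv.arrowCongr σ.symm (Equiv.refl Bool)).bijective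
  rw [← Function.Bijective.sum_comp hΨ (fun ω => A.indicator (weight (p ∘ σ)) ω)]
  refine Finset.sum_congr rfl fun ω _ => ?_
  by_cases hA : ω ∘ σ ∈ A
  · rw [Set.indicator_of_mem hA,
      Set.indicator_of_mem (show ω ∈ (fun ω : Config E => ω ∘ σ) ⁻¹' A from hA), weight_comp]
  · rw [Set.indicator_of_notMem hA,
      Set.indicator_of_notMem (show ω ∉ (fun ω : Config E => ω ∘ σ) ⁻¹' A from hA)]

/-- **Relabelling transport for `B_W`**: along a graph automorphism `(σ, φ)`,
`xwBil ends (φ s) (φ y) (φ o) (φ u) p p = xwBil ends s y o u (p ∘ σ) (p ∘ σ)`. -/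
theorem xwBil_relabel {ends : E → Sym2 V} (σ : E ≃ E) (φ : V ≃ V)
    (hcomp : ∀ e, ends (σ e) = Sym2.map φ (ends e)) (p : E → R) (s y o u : V) :
    xwBil ends (φ s) (φ y) (φ o) (φ u) p p = xwBil ends s y o u (p ∘ σ) (p ∘ σ) :=
  (XWCycle.xwBil_transport' (q := p ∘ σ) (p := p) (ends := ends) (ends' := ends)
    (Ψ := fun ω => ω ∘ σ) (φ := φ) (fun A => prob_comp p σ A)
    (fun ω x z => conn_comp_iff σ φ hcomp ω x z) s y o u).symm

omit [Fintype E] [DecidableEq E] in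
/-- An admissible weight vector stays admissible under reindexing. -/
lemma isProbVec_comp [LinearOrder R] [IsStrictOrderedRing R] {p : E → R} (hp : IsProbVec p)
    (σ : E ≃ E) : IsProbVec (p ∘ σ) where
  nonneg e := hp.nonneg (σ e)
  le_one e := hp.le_one (σ e)

end Transport

end XWRelabel

end Summit.Ventures.PercRepro2
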